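import Summits.KontsevichZagierPeriods.KontsevichZagierPeriods.Theorems.RootDecompZetaThreeFrontierWordCanon

/-!
# Route RootDecompZetaThreeFrontier — kernel edge `GZNormalFormWThree → GenusZeroThreeNormalForm` — part 2/3 (`…WordPackaging`): the packaging support `PackagingTwo` PROVED

The one-variable Newton–Leibniz package on the band `Δ₂`: for rationals `A, Q` the rational representation `packRep A Q` on `Δ₂`
splits in `KZ.FormalRep ⧸ relations` as `[k0 A] + [k2 Q]` (`packRep_split`, `constRep_two_sub_k0_mem`), whence
`packagingTwo_holds : PackagingTwo` and `genusZeroThreeNormalForm_of_two : GZNormalFormW 3 → WordClosureNFThree → GenusZeroThreeNormalForm`.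
The Newton–Leibniz / Stokes engine `newtonLeibniz_pack` is a verbatim private copy of the landed support-collapse lemma (upstream is `private`).
[Kontsevich–Zagier 2001 §1.2 rules (1)–(3)]  Standard axioms, 0 sorry.
-/

noncomputable section

set_option linter.dupNamespace false

open Set MeasureTheory MvPolynomial
open Literature.NumberTheory.Transcendental
open Literature.ModelTheory.ExponentialFields (IsSemialgebraic)
open Summit.KontsevichZagierPeriods.KontsevichZagierPeriods.Theses.RootDecompZetaThreeFrontier
open Summit.KontsevichZagierPeriods.KontsevichZagierPeriods.Theorems.RootDecompZetaThreeFrontierSupportCollapse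
open Summit.KontsevichZagierPeriods.KontsevichZagierPeriods.Theorems.RootDecompZetaThreeFrontierWordMoves

namespace Summit.KontsevichZagierPeriods.KontsevichZagierPeriods.Theorems.RootDecompZetaThreeFrontierWordEdge

variable {w N : ℕ}

/-- A representation whose integrand vanishes on its domain is a relation (rule 1b: `f = f + f`). -/
private theorem of_mem_relations_of_integrand_zero {n : ℕ} (z : KZ.IntegralRep n)
    (hz : ∀ x ∈ z.domain, z.integrand x = 0) : KZ.of z ∈ KZ.relations := by
  have h3 : KZ.of z - KZ.of z - KZ.of z ∈ KZ.relations :=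
    KZ.integrandAddRel_subset_relations ⟨n, z, z, z, rfl, rfl, fun x hx => by simp [hz x hx], rfl⟩
  rw [show KZ.of z - KZ.of z - KZ.of z = -KZ.of z by abel] at h3
  exact neg_mem_iff.mp h3

/-- Congruence: same domain, integrands equal on it ⇒ the two representations differ by a relation
(rule 1b with a zero representation). -/
private theorem of_sub_of_mem_relations {n : ℕ} (r r' : KZ.IntegralRep n) (hd : r'.domain = r.domain)
    (h : EqOn r.integrand r'.integrand r.domain) : KZ.of r - KZ.of r' ∈ KZ.relations := by
  let z : KZ.IntegralRep n := r.constMul 0 isAlgebraic_zero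
  have hz : ∀ x ∈ z.domain, z.integrand x = 0 := fun x _ => by
    simp [z, KZ.IntegralRep.integrand_constMul]
  have h1 : KZ.of r - KZ.of r' - KZ.of z ∈ KZ.relations :=
    KZ.integrandAddRel_subset_relations
      ⟨n, r, r', z, hd, rfl, fun x hx => by simp [z, KZ.IntegralRep.integrand_constMul, h hx], rfl⟩
  have h2 := of_mem_relations_of_integrand_zero z hz
  rw [show KZ.of r - KZ.of r' = (KZ.of r - KZ.of r' - KZ.of z) + KZ.of z by abel]
  exact add_mem h1 h2

/-- `t ↦ Fin.snoc x t` is continuous. [folklore] (verbatim private copy, `Theorems/…SupportCollapse`) -/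
private theorem continuous_snoc {N : ℕ} (x : Fin N → ℝ) :
    Continuous fun t : ℝ => (Fin.snoc x t : Fin (N + 1) → ℝ) := by
  refine continuous_pi fun j => ?_
  refine Fin.lastCases ?_ (fun i => ?_) j
  · simpa using continuous_id'
  · simpa using continuous_const

/-- Splitting off the last coordinate, `ℝ^{N+1} ≃ ℝ^N × ℝ`, as a volume-preserving measurable
equivalence with inverse `(x, t) ↦ Fin.snoc x t`. [folklore] (verbatim private copy) -/
private theorem exists_measurableEquiv_snoc (N : ℕ) :
    ∃ e : (Fin (N + 1) → ℝ) ≃ᵐ (Fin N → ℝ) × ℝ,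
      MeasurePreserving e volume ((volume : Measure (Fin N → ℝ)).prod (volume : Measure ℝ)) ∧
      ∀ q, e.symm q = Fin.snoc q.1 q.2 := by
  refine ⟨(MeasurableEquiv.piFinSuccAbove (fun _ => ℝ) (Fin.last N)).trans
    MeasurableEquiv.prodComm, ?_, fun q => ?_⟩
  · refine (volume_preserving_piFinSuccAbove (fun _ => ℝ) (Fin.last N)).trans ?_
    rw [Measure.volume_eq_prod]
    exact Measure.measurePreserving_swap
  · show (MeasurableEquiv.piFinSuccAbove (fun _ => ℝ) (Fin.last N)).symm (q.2, q.1) = _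
    rw [MeasurableEquiv.piFinSuccAbove_symm_apply, Fin.insertNthEquiv_last]
    rfl

/-- **Newton–Leibniz over an open band, packaged.** Let `r` be a representation whose domain is
the open band `{(x, t) | x ∈ τ, a x < t < b x}` over a semialgebraic base `τ` with semialgebraic
`a < b`, and whose integrand agrees there with `f`; let `F`, `f` be semialgebraic on the closed band;
suppose `t ↦ F (x, t)` is continuous on `[a x, b x]` with derivative `f (x, ·)` on `(a x, b x)`
for `x ∈ τ`. Then `[r] ≡ [τ, F (x, b x) − F (x, a x)]` modulo relations; the base integrand is
absolutely integrable by Fubini and the fundamental theorem of calculus.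
[Kontsevich–Zagier 2001, §1.2, rule (3)] [folklore] (verbatim copy of
`Summit.KontsevichZagierPeriods.ArrangementNormalForm.JanusBands.IntegrateOut.newtonLeibniz_pack`) -/
private theorem newtonLeibniz_pack {N : ℕ} {τ : Set (Fin N → ℝ)} (hτ : IsSemialgebraic ℚ τ)
    {a b : (Fin N → ℝ) → ℝ} (ha : IsSemialgebraicFunOn ℚ τ a) (hb : IsSemialgebraicFunOn ℚ τ b)
    (hab : ∀ x ∈ τ, a x < b x) {f F : (Fin (N + 1) → ℝ) → ℝ}
    (hf : IsSemialgebraicFunOn ℚ (KZlog.band τ a b) f)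
    (hF : IsSemialgebraicFunOn ℚ (KZlog.band τ a b) F)
    (hcont : ∀ x ∈ τ, ContinuousOn (fun t => F (Fin.snoc x t)) (Icc (a x) (b x)))
    (hder : ∀ x ∈ τ, ∀ t ∈ Ioo (a x) (b x),
      HasDerivAt (fun s => F (Fin.snoc x s)) (f (Fin.snoc x t)) t)
    (r : KZ.IntegralRep (N + 1))
    (hrd : r.domain = {z | (Fin.init z : Fin N → ℝ) ∈ τ ∧ a (Fin.init z) < z (Fin.last N) ∧
      z (Fin.last N) < b (Fin.init z)})
    (hri : EqOn r.integrand f r.domain) :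
    ∃ r' : KZ.IntegralRep N, r'.domain = τ ∧
      (r'.integrand = fun x => F (Fin.snoc x (b x)) - F (Fin.snoc x (a x))) ∧
      KZ.of r - KZ.of r' ∈ KZ.relations := by
  have hτm : MeasurableSet τ := IsSemialgebraic.measurableSet_holds hτ
  have hBsa : IsSemialgebraic ℚ (KZlog.band τ a b) := KZlog.isSemialgebraic_band ha hb
  have hBm : MeasurableSet (KZlog.band τ a b) := IsSemialgebraic.measurableSet_holds hBsa
  have hsub : r.domain ⊆ KZlog.band τ a b := by
    rw [hrd]; exact fun z hz => ⟨hz.1, hz.2.1.le, hz.2.2.le⟩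
  have hdiff : KZlog.band τ a b \ r.domain ⊆
      {z | (Fin.init z : Fin N → ℝ) ∈ τ ∧ z (Fin.last N) = a (Fin.init z)} ∪
        {z | (Fin.init z : Fin N → ℝ) ∈ τ ∧ z (Fin.last N) = b (Fin.init z)} := by
    rw [hrd]
    rintro z ⟨⟨hzτ, h1, h2⟩, hz⟩
    simp only [mem_setOf_eq, not_and, not_lt] at hz
    rcases h1.lt_or_eq with h1 | h1
    · exact Or.inr ⟨hzτ, le_antisymm h2 (hz hzτ h1)⟩
    · exact Or.inl ⟨hzτ, h1.symm⟩
  have hnull : volume (KZlog.band τ a b \ r.domain) = 0 :=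
    measure_mono_null hdiff (measure_union_null (KZ.volume_graph_eq_zero ha)
      (KZ.volume_graph_eq_zero hb))
  have hfO : IntegrableOn f r.domain :=
    r.integrableOn.congr_fun hri (KZ.IntegralRep.measurableSet_domain_holds r)
  have hfB : IntegrableOn f (KZlog.band τ a b) := by
    rw [← Set.union_sdiff_cancel hsub]
    exact integrableOn_union.mpr ⟨hfO, IntegrableOn.of_measure_zero hnull⟩
  let r₂ : KZ.IntegralRep (N + 1) := ⟨KZlog.band τ a b, f, hBsa, hf, hfB⟩
  have h12 : KZ.of r - KZ.of r₂ ∈ KZ.relations := by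
    refine KZ.of_sub_of_mem_relations_of_null r r₂ ?_ hnull fun z hz => hri hz.1
    rw [Set.sdiff_eq_empty.mpr hsub, measure_empty]
  -- the base integrand and its semialgebraicity
  have hmap : ∀ {c : (Fin N → ℝ) → ℝ}, IsSemialgebraicFunOn ℚ τ c →
      (∀ x ∈ τ, c x ∈ Icc (a x) (b x)) →
      IsSemialgebraicFunOn ℚ τ (fun x => F (Fin.snoc x (c x))) := by
    intro c hc hcm
    have hφ : IsSemialgebraicMapOn ℚ τ (fun x => (Fin.snoc x (c x) : Fin (N + 1) → ℝ)) := by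
      refine IsSemialgebraicMapOn.of_forall hτ fun j => ?_
      refine Fin.lastCases ?_ (fun i => ?_) j
      · simpa using hc
      · simpa using isSemialgebraicFunOn_apply hτ i
    exact IsSemialgebraicFunOn.comp_isSemialgebraicMapOn_holds hF hφ
      fun x hx => KZlog.snoc_mem_band.mpr ⟨hx, hcm x hx⟩
  have hgsa : IsSemialgebraicFunOn ℚ τ (fun x => F (Fin.snoc x (b x)) - F (Fin.snoc x (a x))) :=
    IsSemialgebraicFunOn.sub_holds (hmap hb fun x hx => Set.right_mem_Icc.mpr (hab x hx).le)
      (hmap ha fun x hx => Set.left_mem_Icc.mpr (hab x hx).le)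
  -- integrability of the base integrand: Fubini and the fundamental theorem of calculus
  set G : (Fin (N + 1) → ℝ) → ℝ := (KZlog.band τ a b).indicator f with hG_def
  have hG : Integrable G := (integrable_indicator_iff hBm).mpr hfB
  obtain ⟨e, he, he_symm⟩ := exists_measurableEquiv_snoc N
  have hG2 : Integrable (fun q : (Fin N → ℝ) × ℝ => G (Fin.snoc q.1 q.2))
      ((volume : Measure (Fin N → ℝ)).prod (volume : Measure ℝ)) := by
    have h := ((he.symm e).integrable_comp_emb e.symm.measurableEmbedding (g := G)).mpr hG
    convert h using 1
    ext q
    simp [he_symm]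
  have hfib_in : ∀ x ∈ τ, (fun t => G (Fin.snoc x t)) =
      (Icc (a x) (b x)).indicator (fun t => f (Fin.snoc x t)) := by
    intro x hx
    ext t
    by_cases ht : t ∈ Icc (a x) (b x)
    · rw [indicator_of_mem ht, hG_def, indicator_of_mem (KZlog.snoc_mem_band.mpr ⟨hx, ht⟩)]
    · rw [indicator_of_notMem ht, hG_def,
        indicator_of_notMem (fun h => ht (KZlog.snoc_mem_band.mp h).2)]
  have hgx : ∀ x ∈ τ, Integrable (fun t => G (Fin.snoc x t)) →
      F (Fin.snoc x (b x)) - F (Fin.snoc x (a x)) = ∫ t, G (Fin.snoc x t) := by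
    intro x hx hxi
    rw [hfib_in x hx, integral_indicator measurableSet_Icc, integral_Icc_eq_integral_Ioc,
      ← intervalIntegral.integral_of_le (hab x hx).le]
    refine (intervalIntegral.integral_eq_sub_of_hasDerivAt_of_le (hab x hx).le (hcont x hx)
      (hder x hx) ?_).symm
    rw [intervalIntegrable_iff_integrableOn_Icc_of_le (hab x hx).le]
    have h' := hxi
    rw [hfib_in x hx] at h'
    exact (integrable_indicator_iff measurableSet_Icc).mp h'
  have hgi : IntegrableOn (fun x => F (Fin.snoc x (b x)) - F (Fin.snoc x (a x))) τ := by
    refine Integrable.mono' hG2.integral_norm_prod_left.integrableOn.integrable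
      (KZ.aestronglyMeasurable_of_isSemialgebraicFunOn hgsa hτm) ?_
    rw [ae_restrict_iff' hτm]
    filter_upwards [hG2.prod_right_ae] with x hx hxτ
    rw [hgx x hxτ hx]
    exact norm_integral_le_integral_norm _
  let r' : KZ.IntegralRep N :=
    ⟨τ, fun x => F (Fin.snoc x (b x)) - F (Fin.snoc x (a x)), hτ, hgsa, hgi⟩
  have h23 : KZ.of r₂ - KZ.of r' ∈ KZ.relations :=
    KZ.newtonLeibnizRel_subset_relations ⟨N, r₂, r', a, b, F, hF, ha, hb,
      fun x hx => (hab x hx).le, rfl, hcont, hder, fun x _ => rfl, rfl⟩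
  refine ⟨r', rfl, rfl, ?_⟩
  have : KZ.of r - KZ.of r' = (KZ.of r - KZ.of r₂) + (KZ.of r₂ - KZ.of r') := by abel
  rw [this]
  exact KZ.relations.add_mem h12 h23

/-- the constant representation `[Δ_k, C]` (`C ∈ ℚ`) -/
def constRep (k : ℕ) (C : ℚ) : KZ.IntegralRep k where
  domain := KZ.openOrderedSimplex k
  integrand := fun _ => (C : ℝ)
  isSemialgebraic_domain := KZ.isSemialgebraic_openOrderedSimplex k
  isSemialgebraicFunOn_integrand :=
    (isSemialgebraicFunOn_aeval (KZ.isSemialgebraic_openOrderedSimplex k) (MvPolynomial.C C)).congr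
      fun t _ => by simp only [MvPolynomial.aeval_C, eq_ratCast]
  integrableOn := integrableOn_const (volume_openOrderedSimplex_ne_top k)

/-- (decomp-kz lens-1, `WordLayer.lean` g9) `constRep_domain`. -/
theorem constRep_domain (k : ℕ) (C : ℚ) : (constRep k C).domain = KZ.openOrderedSimplex k := rfl

/-- the packaged representation `[Δ₂, 2A + Q/(t₀(1 − t₁))]` -/
def packRep (A Q : ℚ) : KZ.IntegralRep 2 where
  domain := KZ.openOrderedSimplex 2
  integrand := fun t => ((2 * A : ℚ) : ℝ) + (k2 Q).integrand t
  isSemialgebraic_domain := KZ.isSemialgebraic_openOrderedSimplex 2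
  isSemialgebraicFunOn_integrand :=
    IsSemialgebraicFunOn.add_holds (constRep 2 (2 * A)).isSemialgebraicFunOn_integrand
      (k2 Q).isSemialgebraicFunOn_integrand
  integrableOn := (constRep 2 (2 * A)).integrableOn.add (k2 Q).integrableOn

/-- (decomp-kz lens-1, `WordLayer.lean` g9) `packRep_integrand`. -/
theorem packRep_integrand (A Q : ℚ) (t : Fin 2 → ℝ) :
    (packRep A Q).integrand t = ((2 * A : ℚ) : ℝ) + (Q : ℝ) / (t 0 * (1 - t 1)) := by
  show ((2 * A : ℚ) : ℝ) + (k2 Q).integrand t = _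
  rw [k2_integrand]

/-- `[Δ₂, 2A + Q/(t₀(1 − t₁))]` is `KZ`-rational: `(2A·t₀(1−t₁) + Q) / (t₀(1−t₁))`. -/
theorem packRep_isRational (A Q : ℚ) : (packRep A Q).IsRational := by
  refine ⟨MvPolynomial.C (2 * A) * (MvPolynomial.X 0 * (1 - MvPolynomial.X 1)) + MvPolynomial.C Q,
    MvPolynomial.X 0 * (1 - MvPolynomial.X 1), fun t ht => ?_, fun t ht => ?_⟩
  · obtain ⟨h1, h10, h0⟩ := (mem_simplex_two_iff t).1 ht
    simp only [map_mul, map_sub, map_one, MvPolynomial.aeval_X]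
    exact mul_ne_zero (h1.trans h10).ne' (sub_ne_zero.2 ((h10.trans h0).ne'))
  · obtain ⟨h1, h10, h0⟩ := (mem_simplex_two_iff t).1 ht
    have ht0 : t 0 ≠ 0 := (h1.trans h10).ne'
    have ht1 : 1 - t 1 ≠ 0 := sub_ne_zero.2 ((h10.trans h0).ne')
    rw [packRep_integrand]
    simp only [map_add, map_mul, map_sub, map_one, MvPolynomial.aeval_C, MvPolynomial.aeval_X, eq_ratCast]
    push_cast
    field_simp

/-- rule 1b: `[Δ₂, 2A + Q·ω₀ω₁] ≡ [Δ₂, 2A] + [Δ₂, Q·ω₀ω₁]` -/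
theorem packRep_split (A Q : ℚ) :
    KZ.of (packRep A Q) - KZ.of (constRep 2 (2 * A)) - KZ.of (k2 Q) ∈ KZ.relations :=
  KZ.integrandAddRel_subset_relations ⟨2, packRep A Q, constRep 2 (2 * A), k2 Q, rfl, rfl,
    fun _ _ => rfl, rfl⟩

/-- `Δ₂` is the band `0 < t₁ < t₀` over `Δ₁` -/
theorem openOrderedSimplex_two_eq_band : KZ.openOrderedSimplex 2 =
    {z : Fin 2 → ℝ | (Fin.init z : Fin 1 → ℝ) ∈ KZ.openOrderedSimplex 1 ∧ (0 : ℝ) < z (Fin.last 1) ∧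
      z (Fin.last 1) < (Fin.init z : Fin 1 → ℝ) (Fin.last 0)} := by
  ext z
  rw [mem_simplex_two_iff]
  simp only [mem_setOf_eq, mem_simplex_one_iff]
  rw [show (Fin.init z : Fin 1 → ℝ) 0 = z 0 from rfl, show (Fin.init z : Fin 1 → ℝ) (Fin.last 0) = z 0 from rfl,
    show z (Fin.last 1) = z 1 from rfl]
  constructor
  · rintro ⟨h1, h10, h0⟩; exact ⟨⟨h1.trans h10, h0⟩, h1, h10⟩
  · rintro ⟨⟨-, h0⟩, h1, h10⟩; exact ⟨h1, h10, h0⟩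

/-- `Δ₁` is the band `0 < y < 1` over the point -/
theorem openOrderedSimplex_one_eq_band : KZ.openOrderedSimplex 1 =
    {z : Fin 1 → ℝ | (Fin.init z : Fin 0 → ℝ) ∈ KZ.openOrderedSimplex 0 ∧ (0 : ℝ) < z (Fin.last 0) ∧
      z (Fin.last 0) < 1} := by
  ext z
  rw [mem_simplex_one_iff]
  simp only [mem_setOf_eq]
  rw [show z (Fin.last 0) = z 0 from rfl]
  exact ⟨fun h => ⟨mem_simplex_zero _, h⟩, fun h => h.2⟩

/-- **Two Newton–Leibniz moves: `[Δ₂, 2A] ≡ [pt, A]`.** -/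
theorem constRep_two_sub_k0_mem (A : ℚ) : KZ.of (constRep 2 (2 * A)) - KZ.of (k0 A) ∈ KZ.relations := by
  set c : ℝ := ((2 * A : ℚ) : ℝ) with hc
  -- move 1: over `Δ₁`, band `0 < t₁ < y (= t₀)`, primitive `c·t₁`
  have hτ₁ := KZ.isSemialgebraic_openOrderedSimplex 1
  have ha₁ : IsSemialgebraicFunOn ℚ (KZ.openOrderedSimplex 1) (fun _ : Fin 1 → ℝ => (0 : ℝ)) :=
    (isSemialgebraicFunOn_aeval hτ₁ (0 : MvPolynomial (Fin 1) ℚ)).congr fun y _ => by simp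
  have hb₁ : IsSemialgebraicFunOn ℚ (KZ.openOrderedSimplex 1) (fun y : Fin 1 → ℝ => y (Fin.last 0)) :=
    (isSemialgebraicFunOn_aeval hτ₁ (MvPolynomial.X (Fin.last 0))).congr fun y _ => by simp
  have hab₁ : ∀ y ∈ KZ.openOrderedSimplex 1, (fun _ : Fin 1 → ℝ => (0 : ℝ)) y < (fun y : Fin 1 → ℝ => y (Fin.last 0)) y :=
    fun y hy => ((mem_simplex_one_iff y).1 hy).1
  have hB₁ := KZlog.isSemialgebraic_band ha₁ hb₁
  have hf₁ : IsSemialgebraicFunOn ℚ (KZlog.band (KZ.openOrderedSimplex 1) (fun _ => (0 : ℝ))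
      (fun y => y (Fin.last 0))) (fun _ : Fin 2 → ℝ => c) :=
    (isSemialgebraicFunOn_aeval hB₁ (MvPolynomial.C (2 * A))).congr fun z _ => by
      simp only [map_mul, MvPolynomial.aeval_C, eq_ratCast, hc]
      all_goals (push_cast; ring)
  have hF₁ : IsSemialgebraicFunOn ℚ (KZlog.band (KZ.openOrderedSimplex 1) (fun _ => (0 : ℝ))
      (fun y => y (Fin.last 0))) (fun z : Fin 2 → ℝ => c * z (Fin.last 1)) :=
    (isSemialgebraicFunOn_aeval hB₁ (MvPolynomial.C (2 * A) * MvPolynomial.X (Fin.last 1))).congr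
      fun z _ => by
        simp only [map_mul, MvPolynomial.aeval_C, MvPolynomial.aeval_X, eq_ratCast, hc]
        all_goals (push_cast; ring)
  obtain ⟨r₁, hd₁, hi₁, hrel₁⟩ := newtonLeibniz_pack hτ₁ ha₁ hb₁ hab₁ hf₁ hF₁
    (fun y _ => by
      simp only [Fin.snoc_last]
      exact (continuous_const.mul continuous_id).continuousOn)
    (fun y _ t _ => by
      simp only [Fin.snoc_last]
      simpa using (hasDerivAt_id t).const_mul c)
    (constRep 2 (2 * A)) (by rw [constRep_domain]; exact openOrderedSimplex_two_eq_band) (fun z _ => rfl)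
  have hi₁' : r₁.integrand = fun y => c * y (Fin.last 0) := by
    rw [hi₁]; funext y; simp only [Fin.snoc_last, mul_zero, sub_zero]
  -- move 2: over the point, band `0 < y < 1`, primitive `A·y²`
  have hτ₀ := KZ.isSemialgebraic_openOrderedSimplex 0
  have ha₀ : IsSemialgebraicFunOn ℚ (KZ.openOrderedSimplex 0) (fun _ : Fin 0 → ℝ => (0 : ℝ)) :=
    (isSemialgebraicFunOn_aeval hτ₀ (0 : MvPolynomial (Fin 0) ℚ)).congr fun y _ => by simp
  have hb₀ : IsSemialgebraicFunOn ℚ (KZ.openOrderedSimplex 0) (fun _ : Fin 0 → ℝ => (1 : ℝ)) :=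
    (isSemialgebraicFunOn_aeval hτ₀ (1 : MvPolynomial (Fin 0) ℚ)).congr fun y _ => by simp
  have hab₀ : ∀ y ∈ KZ.openOrderedSimplex 0, (fun _ : Fin 0 → ℝ => (0 : ℝ)) y < (fun _ : Fin 0 → ℝ => (1 : ℝ)) y :=
    fun _ _ => zero_lt_one
  have hB₀ := KZlog.isSemialgebraic_band ha₀ hb₀
  have hf₀ : IsSemialgebraicFunOn ℚ (KZlog.band (KZ.openOrderedSimplex 0) (fun _ => (0 : ℝ)) (fun _ => (1 : ℝ)))
      r₁.integrand := by
    rw [hi₁']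
    exact (isSemialgebraicFunOn_aeval hB₀ (MvPolynomial.C (2 * A) * MvPolynomial.X (Fin.last 0))).congr
      fun z _ => by
        simp only [map_mul, MvPolynomial.aeval_C, MvPolynomial.aeval_X, eq_ratCast, hc]
        all_goals (push_cast; ring)
  have hF₀ : IsSemialgebraicFunOn ℚ (KZlog.band (KZ.openOrderedSimplex 0) (fun _ => (0 : ℝ)) (fun _ => (1 : ℝ)))
      (fun z : Fin 1 → ℝ => (A : ℝ) * z (Fin.last 0) ^ 2) :=
    (isSemialgebraicFunOn_aeval hB₀ (MvPolynomial.C A * MvPolynomial.X (Fin.last 0) ^ 2)).congr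
      fun z _ => by simp only [map_mul, map_pow, MvPolynomial.aeval_C, MvPolynomial.aeval_X, eq_ratCast]
  have hsq : ∀ t : ℝ, HasDerivAt (fun s : ℝ => (A : ℝ) * s ^ 2) (c * t) t := fun t => by
    have h := ((hasDerivAt_id t).mul (hasDerivAt_id t)).const_mul (A : ℝ)
    simp only [id, hc] at h ⊢
    refine (h.congr_of_eventuallyEq ?_).congr_deriv ?_
    · exact Filter.Eventually.of_forall fun s => by simp [sq]
    · push_cast; ring
  obtain ⟨r₀, hd₀, hi₀, hrel₀⟩ := newtonLeibniz_pack hτ₀ ha₀ hb₀ hab₀ hf₀ hF₀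
    (fun y _ => by
      simp only [Fin.snoc_last]
      exact (continuous_const.mul (continuous_pow 2)).continuousOn)
    (fun y _ t _ => by
      rw [hi₁']
      simp only [Fin.snoc_last]
      exact hsq t)
    r₁ (by rw [hd₁]; exact openOrderedSimplex_one_eq_band) (fun z _ => rfl)
  -- congruence `r₀ ≡ [pt, A]`
  have h₀ : KZ.of r₀ - KZ.of (k0 A) ∈ KZ.relations :=
    of_sub_of_mem_relations r₀ (k0 A) (by rw [hd₀]; rfl) fun x _ => by
      rw [hi₀, k0_integrand]
      simp only [Fin.snoc_last]
      ring
  have e : KZ.of (constRep 2 (2 * A)) - KZ.of (k0 A) =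
      (KZ.of (constRep 2 (2 * A)) - KZ.of r₁) + (KZ.of r₁ - KZ.of r₀) + (KZ.of r₀ - KZ.of (k0 A)) := by abel
  rw [e]
  exact add_mem (add_mem hrel₁ hrel₀) h₀

/-- **`PackagingTwo` holds** (hence the 28709 support `PackagingTwo'` is born CLOSED). -/
theorem packagingTwo_holds : PackagingTwo := by
  intro A Q
  refine ⟨packRep A Q, packRep_isRational A Q, ?_⟩
  have e : KZ.of (packRep A Q) - (KZ.of (k0 A) + KZ.of (k2 Q)) =
      (KZ.of (packRep A Q) - KZ.of (constRep 2 (2 * A)) - KZ.of (k2 Q)) +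
        (KZ.of (constRep 2 (2 * A)) - KZ.of (k0 A)) := by abel
  rw [e]
  exact add_mem (packRep_split A Q) (constRep_two_sub_k0_mem A)

/-- **Item 28709 from TWO supports** (the third is a theorem): `GZNormalFormW 3 → WordClosureNFThree →
GenusZeroThreeNormalForm`, and the same in route vocabulary. -/
theorem genusZeroThreeNormalForm_of_two (hN : GZNormalFormW 3) (hW : WordClosureNFThree) :
    Summit.KontsevichZagierPeriods.KontsevichZagierPeriods.Theses.RootDecompZetaThreeFrontier.GenusZeroThreeNormalForm :=
  genusZeroThreeNormalForm_of_graded hN hW packagingTwo_holds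

end Summit.KontsevichZagierPeriods.KontsevichZagierPeriods.Theorems.RootDecompZetaThreeFrontierWordEdge
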